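import Literature.NumberTheory.QuadraticFields.BakerLimitFormulaBesselLimit
import Literature.NumberTheory.QuadraticFields.BakerLimitFormulaBesselBound
import Literature.NumberTheory.QuadraticFields.BakerLimitFormulaMain
import Literature.NumberTheory.QuadraticFields.QuadraticDedekindZeta
import Mathlib.NumberTheory.Harmonic.ZetaAsymp
import HarnessLib

/-!
# The Epstein zeta function at `s = 1`: residue `2π/√|d|` and the constant term
# `2ζ(2)/a − (2π/√|d|) log(|d|/a) + O(1/√|d|)` (Kronecker's first limit formula, bounded form)

Topic `NumberTheory/QuadraticFields`, namespace `Literature.NumberTheory.QuadraticFields.KroneckerLimit`.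
Everything here is PROVED (theorems only, no definitions, no named facts).

For a positive definite binary quadratic form `f = ax² + bxy + cy²` (real coefficients,
`|d| = 4ac − b² > 0`, `κ = √|d|/(2a)`) the Epstein zeta function
`Z_f(s) = Σ'_{(x,y)} f(x,y)^{−s}` (`Literature.Barriers.RiemannHypothesis.epsteinZeta`, `Re s > 1`) is,
by the `K`-Bessel (Chowla–Selberg / Rankin / Bateman–Grosswald) expansion organised in the tree's
`BakerLimitFormula*` files (with trivial weight `w = 1` and modulus `k = 1`),

  `Z_f(s) = 2a^{−s}ζ(2s) + 2A(s)ζ(2s − 1) + 2B(s)`,  `A(s) = a^{−s}κ^{1−2s}π^{½}Γ(s−½)/Γ(s)`,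

with `B(s)` the sum of the Bessel parts (`epsteinZeta_eq_three_terms`). Since `A(1) = 2π/√|d|`
(`mainCoeff_one_one`), `A` is holomorphic at `1`, `ζ(2s−1) = 1/(2s−2) + ζ₀(2s−1)` with `ζ₀(1) = γ`
(Mathlib `riemannZeta_eq_inv_sub_add`, `riemannZeta₀`), and `B` is continuous at `1`
(`tendsto_tsum_besselPart`) and exponentially small there (`norm_tsum_besselPart_one_le_of_le_half`),
we obtain, as `s → 1⁺` along the reals:

* `tendsto_epsteinZeta_sub_pole` — `Z_f(s) − (2π/√|d|)/(s − 1) → C_f` with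
  `C_f = 2ζ(2)/a + A'(1) + 2γA(1) + 2B(1)` and
  `A'(1) = (1/(aκ))(−π log(aκ²) + c_Γ)`, `c_Γ = (d/ds)[π^{½}Γ(s−½)/Γ(s)]_{s=1}` an absolute constant;
* `tendsto_sub_one_mul_epsteinZeta` — `(s − 1)Z_f(s) → 2π/√|d|` (the residue: Kronecker / Dirichlet);
* `exists_norm_constantTerm_sub_le` — **the bounded form of Kronecker's limit formula**: there is an
  absolute constant `C` such that for every positive definite `f` with `e^{−2πκ} ≤ ½` (e.g. every
  reduced form, `κ ≥ √3/2`) the constant term satisfies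
  `‖C_f − (2ζ(2)/a − (2π/√|d|) log(|d|/a))‖ ≤ C/√|d|`.

This is the form in which the limit formula enters Granville–Stark's eq. (11) (Invent. Math. 139
(2000), §3.2, from Selberg–Chowla, J. reine angew. Math. 227 (1967), last display of p. 109:
"`L'(1, χ)/… = (π²/6)∑1/a + (π/√d)∑ log(a/d) + O(…)`"); the exact constant (`2γ − 2log 2` in place of
`c_Γ/π + 2γ + log 4`, i.e. `c_Γ = −2π log 2`, and the `η`-product) is Kronecker's first limit formula
(Siegel, *Advanced Analytic Number Theory*, Ch. I §1, Theorem 1), which we do not need.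

## References

* [GranvilleStark2000] A. Granville, H. M. Stark, Invent. Math. 139 (2000), §3.2 eq. (11) (p. 516).
* A. Selberg, S. Chowla, *On Epstein's zeta-function*, J. reine angew. Math. 227 (1967), 86–110,
  p. 109 (cited through [GranvilleStark2000]).
* [Baker1975] A. Baker, *Transcendental Number Theory* (1975), Ch. 5 §§2–3 (the expansion used).
* [BatemanGrosswald1964] P. T. Bateman, E. Grosswald, Acta Arith. 9 (1964), Theorem 1.
* C. L. Siegel, *Advanced Analytic Number Theory*, TIFR/ Springer 1980, Ch. I §1 Thm. 1 (Kronecker's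
  first limit formula).
-/

noncomputable section

open Filter Topology Real Complex
open Literature.Barriers.RiemannHypothesis Literature.NumberTheory.QuadraticFields.BakerLimitFormula

namespace Literature.NumberTheory.QuadraticFields.KroneckerLimit

variable {a b c : ℝ}

/-! ## The untwisted Epstein zeta function as a `twistZeta` with weight `1` and modulus `1` -/

/-- `twistTerm 1 = epsteinTerm`. [folklore] -/
theorem twistTerm_one (a b c : ℝ) (s : ℂ) (p : ℤ × ℤ) :
    twistTerm (fun _ => (1 : ℂ)) a b c s p = epsteinTerm a b c s p := by
  simp [twistTerm]

/-- `twistZeta 1 = epsteinZeta`. [folklore] -/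
theorem twistZeta_one (a b c : ℝ) (s : ℂ) :
    twistZeta (fun _ => (1 : ℂ)) a b c s = epsteinZeta a b c s := by
  unfold twistZeta epsteinZeta
  exact tsum_congr fun p => twistTerm_one a b c s p

/-- The weight `1` is bounded by `1`. [folklore] -/
theorem norm_weight_one_le (p : ℤ × ℤ) : ‖(fun _ : ℤ × ℤ => (1 : ℂ)) p‖ ≤ 1 := by simp

/-! ## The line `y = 0`: `Σ_{x ≠ 0} (a x²)^{−s} = 2 a^{−s} ζ(2s)` -/

/-- `((n+1)²)^{−s} = (n+1)^{−2s}` for the real base `(n+1)²`. [folklore] -/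
theorem sq_succ_cpow_neg' (n : ℕ) (s : ℂ) :
    ((((((n + 1 : ℕ) : ℤ) : ℝ) ^ 2 : ℝ)) : ℂ) ^ (-s) = ((n + 1 : ℕ) : ℂ) ^ (-(2 * s)) := by
  have hn : (0 : ℝ) ≤ ((n + 1 : ℕ) : ℝ) := by positivity
  have e : ((((n + 1 : ℕ) : ℤ) : ℝ) ^ 2 : ℝ) = ((n + 1 : ℕ) : ℝ) ^ (2 : ℕ) := by push_cast; ring
  rw [e, Complex.ofReal_pow, ← Complex.cpow_nat_mul']
  · push_cast; ring_nf
  · simp only [Complex.ofReal_natCast, Complex.natCast_arg]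
    norm_num
    exact Real.pi_pos
  · simp only [Complex.ofReal_natCast, Complex.natCast_arg]
    norm_num
    exact Real.pi_pos.le

/-- **The line `y = 0`**: `Σ_{x ∈ ℤ} f(x, 0)^{−s} = 2 a^{−s} ζ(2s)` (`Re s > 1`; the origin contributes
`0`). [cite: Baker1975, Ch. 5 §2] -/
theorem tsum_line_zero (h : IsPosDefForm a b c) {s : ℂ} (hs : 1 < s.re) :
    ∑' x : ℤ, twistTerm (fun _ => (1 : ℂ)) a b c s (x, 0) =
      2 * ((a : ℂ) ^ (-s) * riemannZeta (2 * s)) := by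
  obtain ⟨-, -, hline⟩ := twistZeta_eq_tsum_lines h norm_weight_one_le hs
  have heven : Function.Even fun x : ℤ => twistTerm (fun _ => (1 : ℂ)) a b c s (x, 0) := by
    intro x
    simp only [twistTerm_one]
    have h1 := epsteinTerm_neg_neg a b c s x 0
    rw [neg_zero] at h1
    exact h1
  rw [tsum_int_eq_zero_add_two_mul_tsum_pnat heven (hline 0)]
  have h0 : twistTerm (fun _ => (1 : ℂ)) a b c s ((0 : ℤ), 0) = 0 := by
    simp [twistTerm, epsteinTerm]
  rw [h0, zero_add, nsmul_eq_mul, Nat.cast_ofNat,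
    tsum_pnat_eq_tsum_succ (f := fun n : ℕ => twistTerm (fun _ => (1 : ℂ)) a b c s ((n : ℤ), 0))]
  congr 1
  have h2s : 1 < (2 * s).re := by simp; linarith
  rw [zeta_eq_tsum_one_div_nat_add_one_cpow h2s, ← tsum_mul_left]
  refine tsum_congr fun n => ?_
  have hn0 : ((((n + 1 : ℕ) : ℤ), (0 : ℤ)) : ℤ × ℤ) ≠ 0 := fun h => by
    have := congrArg Prod.fst h; simp at this; omega
  simp only [twistTerm_one, epsteinTerm, Nat.cast_succ]
  rw [if_neg (by exact_mod_cast hn0)]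
  have e1 : bqfEval a b c (((n : ℤ) + 1), 0) = a * ((((n + 1 : ℕ) : ℤ) : ℝ) ^ 2 : ℝ) := by
    unfold bqfEval; push_cast; ring
  have hsq : (0 : ℝ) ≤ ((((n + 1 : ℕ) : ℤ) : ℝ) ^ 2 : ℝ) := sq_nonneg _
  rw [e1, Complex.ofReal_mul, Complex.mul_cpow_ofReal_nonneg h.a_pos.le hsq, sq_succ_cpow_neg' n s]
  simp only [Complex.cpow_neg, one_div]
  push_cast
  ring_nf

/-! ## The lines `y ≥ 1`: main parts sum to `A(s) ζ(2s − 1)` -/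

/-- The line character sum of the weight `1` with modulus `1` is `1`. [folklore] -/
theorem lineCharSum_one (y : ℤ) : lineCharSum (fun _ : ℤ × ℤ => (1 : ℂ)) 1 y = 1 := by
  simp [lineCharSum]

/-- **The main parts sum to `A(s) ζ(2s − 1)`** (`k = 1`, `w = 1`, `Re s > 1`), `A = mainCoeff a b c 1`.
[cite: Baker1975, Ch. 5 §3] -/
theorem hasSum_mainPart_one (h : IsPosDefForm a b c) {s : ℂ} (hs : 1 < s.re) :
    HasSum (fun y : ℕ => mainPart (fun _ : ℤ × ℤ => (1 : ℂ)) a b c 1 s ((y + 1 : ℕ) : ℤ))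
      (mainCoeff a b c 1 s * riemannZeta (2 * s - 1)) := by
  have hw : 1 < (2 * s - 1).re := by simp; linarith
  simp_rw [mainPart_eq_mainCoeff_mul h one_pos (fun _ : ℤ × ℤ => (1 : ℂ)) s, lineCharSum_one, one_mul]
  refine HasSum.mul_left _ ?_
  rw [riemannZeta_eq_tsum_succ_cpow_neg hw]
  exact (summable_succ_cpow_neg hw).hasSum

/-- **`Z_f(s) = 2a^{−s}ζ(2s) + 2(A(s)ζ(2s−1) + B(s))`** for `Re s > 1`, where
`B(s) = Σ_{y≥1} besselPart_y(s)` (summable): the untwisted case `w = 1`, `k = 1` of the tree's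
line/main-part/Bessel-part organisation of the Chowla–Selberg expansion.
[cite: Baker1975, Ch. 5 §§2–3] [cite: BatemanGrosswald1964, Theorem 1] -/
theorem epsteinZeta_eq_three_terms (h : IsPosDefForm a b c) {s : ℂ} (hs : 1 < s.re) :
    epsteinZeta a b c s = 2 * ((a : ℂ) ^ (-s) * riemannZeta (2 * s)) +
        2 * (mainCoeff a b c 1 s * riemannZeta (2 * s - 1) +
          ∑' y : ℕ, besselPart (fun _ : ℤ × ℤ => (1 : ℂ)) a b c 1 s ((y + 1 : ℕ) : ℤ)) ∧
      Summable (fun y : ℕ => besselPart (fun _ : ℤ × ℤ => (1 : ℂ)) a b c 1 s ((y + 1 : ℕ) : ℤ)) := by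
  obtain ⟨hZ, hsum⟩ := twistZeta_eq_line_zero_add h norm_weight_one_le (fun _ => rfl) hs
  have hline : ∀ y : ℕ, ∑' x : ℤ, twistTerm (fun _ : ℤ × ℤ => (1 : ℂ)) a b c s (x, ((y + 1 : ℕ) : ℤ)) =
      mainPart (fun _ : ℤ × ℤ => (1 : ℂ)) a b c 1 s ((y + 1 : ℕ) : ℤ) +
        besselPart (fun _ : ℤ × ℤ => (1 : ℂ)) a b c 1 s ((y + 1 : ℕ) : ℤ) :=
    fun y => tsum_twistLine_eq_mainPart_add_besselPart h norm_weight_one_le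
      (by positivity : (0 : ℤ) < ((y + 1 : ℕ) : ℤ)) (fun _ => rfl) hs
  have hM := hasSum_mainPart_one h hs
  have hB : Summable (fun y : ℕ => besselPart (fun _ : ℤ × ℤ => (1 : ℂ)) a b c 1 s ((y + 1 : ℕ) : ℤ)) := by
    refine ((hsum.congr hline).sub hM.summable).congr fun y => ?_
    ring
  refine ⟨?_, hB⟩
  rw [← twistZeta_one, hZ, tsum_line_zero h hs, tsum_congr hline, hM.summable.tsum_add hB, hM.tsum_eq]

/-! ## The coefficient `A(s) = a^{−s} κ^{1−2s} π^{½} Γ(s−½)/Γ(s)` at and near `s = 1` -/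

/-- `A(s)` for `k = 1` as a product of the elementary factor `a^{−s}κ^{1−2s}` and the Gamma factor
`π^{½}Γ(s−½)/Γ(s)`. [folklore] -/
theorem mainCoeff_one_eq (a b c : ℝ) (s : ℂ) :
    mainCoeff a b c 1 s = ((a : ℂ) ^ (-s) * ((starkK a b c : ℝ) : ℂ) ^ (1 - 2 * s)) *
      ((π : ℂ) ^ (1 / 2 : ℂ) * Complex.Gamma (s - 1 / 2) / Complex.Gamma s) := by
  unfold mainCoeff
  simp only [Nat.cast_one, one_cpow, mul_one, div_one]
  ring

/-- `a κ = √(4ac − b²)/2`. [folklore] -/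
theorem a_mul_starkK (h : IsPosDefForm a b c) : a * starkK a b c = Real.sqrt (4 * a * c - b ^ 2) / 2 := by
  unfold starkK
  have ha := h.a_pos.ne'
  field_simp

/-- **`A(1) = 2π/√(4ac − b²)`** — the residue of `Z_f` at `s = 1` (`π^{½}Γ(½) = π`, `aκ = √|d|/2`).
[cite: BatemanGrosswald1964, Theorem 1] -/
theorem mainCoeff_one_one (h : IsPosDefForm a b c) :
    mainCoeff a b c 1 1 = ((2 * π / Real.sqrt (4 * a * c - b ^ 2) : ℝ) : ℂ) := by
  have ha := h.a_pos
  have hκ := starkK_pos h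
  have hD : 0 < 4 * a * c - b ^ 2 := by linarith [h.disc_neg]
  have hsq : 0 < Real.sqrt (4 * a * c - b ^ 2) := Real.sqrt_pos.mpr hD
  rw [mainCoeff_one_eq]
  have h1 : (1 : ℂ) - 2 * 1 = -1 := by norm_num
  rw [h1, Complex.cpow_neg_one, Complex.cpow_neg_one, show (1 : ℂ) - 1 / 2 = 1 / 2 by norm_num,
    Complex.Gamma_one_half_eq, Complex.Gamma_one, div_one, ← Complex.cpow_add _ _
      (Complex.ofReal_ne_zero.mpr Real.pi_pos.ne'), show (1 / 2 : ℂ) + 1 / 2 = 1 by norm_num,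
    Complex.cpow_one]
  have hak : ((a : ℂ))⁻¹ * ((starkK a b c : ℝ) : ℂ)⁻¹ = (((a * starkK a b c)⁻¹ : ℝ) : ℂ) := by
    push_cast
    rw [mul_inv]
  rw [hak, a_mul_starkK h]
  push_cast
  field_simp

/-- The elementary factor `E(s) = a^{−s} κ^{1−2s}` is entire with `E'(s) = E(s)(−log a − 2 log κ)`.
[folklore] -/
theorem hasDerivAt_powFactor (h : IsPosDefForm a b c) (s : ℂ) :
    HasDerivAt (fun s : ℂ => (a : ℂ) ^ (-s) * ((starkK a b c : ℝ) : ℂ) ^ (1 - 2 * s))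
      (((a : ℂ) ^ (-s) * ((starkK a b c : ℝ) : ℂ) ^ (1 - 2 * s)) *
        (-(Real.log a : ℂ) - 2 * (Real.log (starkK a b c) : ℂ))) s := by
  have ha : (a : ℂ) ≠ 0 := Complex.ofReal_ne_zero.mpr h.a_pos.ne'
  have hκ : ((starkK a b c : ℝ) : ℂ) ≠ 0 := Complex.ofReal_ne_zero.mpr (starkK_pos h).ne'
  have h1 : HasDerivAt (fun s : ℂ => (a : ℂ) ^ (-s)) ((a : ℂ) ^ (-s) * Complex.log a * (-1)) s :=
    (hasDerivAt_neg s).const_cpow (Or.inl ha)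
  have hl : HasDerivAt (fun s : ℂ => 1 - 2 * s) (-2) s := by
    simpa using ((hasDerivAt_id s).const_mul (2 : ℂ)).const_sub 1
  have h2 : HasDerivAt (fun s : ℂ => ((starkK a b c : ℝ) : ℂ) ^ (1 - 2 * s))
      (((starkK a b c : ℝ) : ℂ) ^ (1 - 2 * s) * Complex.log (starkK a b c) * (-2)) s :=
    hl.const_cpow (Or.inl hκ)
  refine (h1.mul h2).congr_deriv ?_
  rw [Complex.ofReal_log h.a_pos.le, Complex.ofReal_log (starkK_pos h).le]
  ring

/-- `Γ` is complex differentiable at the positive reals `1` and `½`. [folklore] -/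
theorem differentiableAt_Gamma_of_pos {x : ℝ} (hx : 0 < x) : DifferentiableAt ℂ Complex.Gamma (x : ℂ) :=
  Complex.differentiableAt_Gamma _ fun m h => by
    have := congrArg Complex.re h
    simp at this
    have : (0 : ℝ) ≤ m := Nat.cast_nonneg m
    linarith

/-- The Gamma factor `G(s) = π^{½} Γ(s − ½)/Γ(s)` is complex differentiable at `s = 1`. [folklore] -/
theorem differentiableAt_gammaFactor :
    DifferentiableAt ℂ (fun s : ℂ => (π : ℂ) ^ (1 / 2 : ℂ) * Complex.Gamma (s - 1 / 2) / Complex.Gamma s) 1 := by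
  have hΓ1 : DifferentiableAt ℂ Complex.Gamma (1 : ℂ) := by
    simpa using differentiableAt_Gamma_of_pos one_pos
  have hΓh : DifferentiableAt ℂ Complex.Gamma ((fun s : ℂ => s - 1 / 2) 1) := by
    have := differentiableAt_Gamma_of_pos (x := 1 / 2) (by norm_num)
    convert this using 2
    push_cast
    norm_num
  refine ((differentiableAt_const _).mul (hΓh.comp 1 (differentiableAt_id.sub_const _))).div hΓ1 ?_
  rw [Complex.Gamma_one]
  exact one_ne_zero

/-- `G(1) = π^{½} Γ(½)/Γ(1) = π`. [folklore] -/
theorem gammaFactor_one :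
    (π : ℂ) ^ (1 / 2 : ℂ) * Complex.Gamma (1 - 1 / 2) / Complex.Gamma 1 = π := by
  rw [show (1 : ℂ) - 1 / 2 = 1 / 2 by norm_num, Complex.Gamma_one_half_eq, Complex.Gamma_one, div_one,
    ← Complex.cpow_add _ _ (Complex.ofReal_ne_zero.mpr Real.pi_pos.ne'),
    show (1 / 2 : ℂ) + 1 / 2 = 1 by norm_num, Complex.cpow_one]

/-- **`A` is holomorphic at `1`**, with
`A'(1) = (aκ)⁻¹ (π(−log a − 2 log κ) + c_Γ)`, `c_Γ = G'(1)`, `G(s) = π^{½}Γ(s−½)/Γ(s)`. [folklore] -/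
theorem hasDerivAt_mainCoeff_one (h : IsPosDefForm a b c) :
    HasDerivAt (fun s : ℂ => mainCoeff a b c 1 s)
      ((((a * starkK a b c)⁻¹ : ℝ) : ℂ) *
        ((π : ℂ) * (-(Real.log a : ℂ) - 2 * (Real.log (starkK a b c) : ℂ)) +
          deriv (fun s : ℂ => (π : ℂ) ^ (1 / 2 : ℂ) * Complex.Gamma (s - 1 / 2) / Complex.Gamma s) 1)) 1 := by
  have hfun : (fun s : ℂ => mainCoeff a b c 1 s) = fun s : ℂ =>
      ((a : ℂ) ^ (-s) * ((starkK a b c : ℝ) : ℂ) ^ (1 - 2 * s)) *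
        ((π : ℂ) ^ (1 / 2 : ℂ) * Complex.Gamma (s - 1 / 2) / Complex.Gamma s) :=
    funext fun s => mainCoeff_one_eq a b c s
  rw [hfun]
  have hE := hasDerivAt_powFactor h 1
  have hG := differentiableAt_gammaFactor.hasDerivAt
  refine (hE.mul hG).congr_deriv ?_
  have h1 : (1 : ℂ) - 2 * 1 = -1 := by norm_num
  rw [gammaFactor_one, h1, Complex.cpow_neg_one, Complex.cpow_neg_one]
  have hak : ((a : ℂ))⁻¹ * ((starkK a b c : ℝ) : ℂ)⁻¹ = (((a * starkK a b c)⁻¹ : ℝ) : ℂ) := by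
    push_cast
    rw [mul_inv]
  rw [← hak]
  ring

/-- The difference quotient of `A` at `1` along `s → 1⁺` tends to `A'(1)`. [folklore] -/
theorem tendsto_slope_mainCoeff (h : IsPosDefForm a b c) :
    Tendsto (fun s : ℝ => (mainCoeff a b c 1 s - mainCoeff a b c 1 1) / ((s : ℂ) - 1)) (𝓝[>] 1)
      (𝓝 ((((a * starkK a b c)⁻¹ : ℝ) : ℂ) *
        ((π : ℂ) * (-(Real.log a : ℂ) - 2 * (Real.log (starkK a b c) : ℂ)) +
          deriv (fun s : ℂ => (π : ℂ) ^ (1 / 2 : ℂ) * Complex.Gamma (s - 1 / 2) / Complex.Gamma s) 1))) := by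
  have hD := hasDerivAt_iff_tendsto_slope.mp (hasDerivAt_mainCoeff_one h)
  refine (hD.comp Quadratic.tendsto_ofReal_nhdsGT_one).congr fun s => ?_
  simp only [Function.comp_apply, slope_def_field]

/-! ## The limit `s → 1⁺` -/

/-- `2a^{−s}ζ(2s) → 2ζ(2)/a` as `s → 1⁺`. [folklore] -/
theorem tendsto_lineZero_term (h : IsPosDefForm a b c) :
    Tendsto (fun s : ℝ => 2 * ((a : ℂ) ^ (-(s : ℂ)) * riemannZeta (2 * (s : ℂ)))) (𝓝[>] 1)
      (𝓝 (2 * ((a : ℂ)⁻¹ * riemannZeta 2))) := by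
  have ha : (a : ℂ) ≠ 0 := Complex.ofReal_ne_zero.mpr h.a_pos.ne'
  have hζ : ContinuousAt riemannZeta ((fun z : ℂ => 2 * z) 1) := by
    refine (differentiableAt_riemannZeta ?_).continuousAt
    norm_num
  have hcont : ContinuousAt (fun z : ℂ => 2 * ((a : ℂ) ^ (-z) * riemannZeta (2 * z))) 1 :=
    continuousAt_const.mul ((continuousAt_id.neg.const_cpow (Or.inl ha)).mul
      (hζ.comp (continuousAt_const.mul continuousAt_id)))
  have h2 := hcont.tendsto.comp ((Complex.continuous_ofReal.tendsto (1 : ℝ)).mono_left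
    (nhdsWithin_le_nhds (s := Set.Ioi (1 : ℝ))))
  have e : 2 * ((a : ℂ) ^ (-(1 : ℂ)) * riemannZeta (2 * 1)) = 2 * ((a : ℂ)⁻¹ * riemannZeta 2) := by
    rw [Complex.cpow_neg_one, mul_one]
  rw [← e]
  exact h2

/-- `2A(s)ζ₀(2s − 1) → 2γ A(1)` as `s → 1⁺` (`ζ₀(1) = γ`). [folklore] -/
theorem tendsto_mainCoeff_mul_zeta₀ (h : IsPosDefForm a b c) :
    Tendsto (fun s : ℝ => 2 * mainCoeff a b c 1 s * riemannZeta₀ (2 * (s : ℂ) - 1)) (𝓝[>] 1)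
      (𝓝 (2 * Real.eulerMascheroniConstant * ((2 * π / Real.sqrt (4 * a * c - b ^ 2) : ℝ) : ℂ))) := by
  have hA := tendsto_mainCoeff h one_pos
  have hz : ContinuousAt (fun z : ℂ => riemannZeta₀ (2 * z - 1)) 1 :=
    differentiable_riemannZeta₀.continuous.continuousAt.comp
      ((continuousAt_const.mul continuousAt_id).sub continuousAt_const)
  have hz' := hz.tendsto.comp ((Complex.continuous_ofReal.tendsto (1 : ℝ)).mono_left
    (nhdsWithin_le_nhds (s := Set.Ioi (1 : ℝ))))
  have := (hA.mul hz').const_mul (2 : ℂ)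
  simp only [Function.comp_def, mul_one] at this
  rw [show (2 : ℂ) - 1 = 1 by norm_num, riemannZeta₀_one, mainCoeff_one_one h] at this
  convert this using 2
  · ring
  · ring

/-- **The constant term of `Z_f` at `s = 1`.** As `s → 1⁺` along the reals,
`Z_f(s) − (2π/√|d|)/(s − 1) → 2ζ(2)/a + (A'(1) + 2γA(1)) + 2B(1)`, where `A(1) = 2π/√|d|`,
`A'(1) = (aκ)⁻¹(π(−log a − 2log κ) + c_Γ)` with the absolute constant
`c_Γ = (d/ds)[π^{½}Γ(s−½)/Γ(s)]_{s=1}`, and `B(1) = Σ_{y≥1} besselPart_y(1)` — Kronecker's first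
limit formula up to the identification of the constants (Selberg–Chowla's display on p. 109 as
used in Granville–Stark (11)). [cite: GranvilleStark2000, §3.2 eq. (11)] -/
theorem tendsto_epsteinZeta_sub_pole (h : IsPosDefForm a b c) :
    Tendsto (fun s : ℝ => epsteinZeta a b c s -
        ((2 * π / Real.sqrt (4 * a * c - b ^ 2) : ℝ) : ℂ) / ((s : ℂ) - 1)) (𝓝[>] 1)
      (𝓝 (2 * ((a : ℂ)⁻¹ * riemannZeta 2) +
        ((((a * starkK a b c)⁻¹ : ℝ) : ℂ) *
            ((π : ℂ) * (-(Real.log a : ℂ) - 2 * (Real.log (starkK a b c) : ℂ)) +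
              deriv (fun s : ℂ => (π : ℂ) ^ (1 / 2 : ℂ) * Complex.Gamma (s - 1 / 2) / Complex.Gamma s) 1) +
          2 * Real.eulerMascheroniConstant * ((2 * π / Real.sqrt (4 * a * c - b ^ 2) : ℝ) : ℂ)) +
        2 * ∑' y : ℕ, besselPart (fun _ : ℤ × ℤ => (1 : ℂ)) a b c 1 1 ((y + 1 : ℕ) : ℤ))) := by
  have hT := ((tendsto_lineZero_term h).add ((tendsto_slope_mainCoeff h).add
    (tendsto_mainCoeff_mul_zeta₀ h))).add
      ((tendsto_tsum_besselPart h one_pos norm_weight_one_le).const_mul (2 : ℂ))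
  refine hT.congr' ?_
  filter_upwards [self_mem_nhdsWithin] with s hs
  simp only [Set.mem_Ioi] at hs
  have hs' : 1 < ((s : ℂ)).re := by simpa using hs
  obtain ⟨hZ, -⟩ := epsteinZeta_eq_three_terms h hs'
  have hne : (s : ℂ) - 1 ≠ 0 := by
    rw [sub_ne_zero, ← Complex.ofReal_one, Ne, Complex.ofReal_inj]
    exact ne_of_gt hs
  have hne2 : 2 * (s : ℂ) - 1 ≠ 1 := by
    intro h2
    apply hne
    linear_combination h2 / 2
  have hne3 : 2 * (s : ℂ) - 1 - 1 ≠ 0 := by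
    intro h3
    apply hne
    linear_combination h3 / 2
  have hζ := riemannZeta_eq_inv_sub_add hne2
  rw [hZ, hζ, mainCoeff_one_one h]
  set r : ℝ := 2 * π / Real.sqrt (4 * a * c - b ^ 2) with hr
  field_simp
  ring

/-- **The residue of `Z_f` at `s = 1` is `2π/√|d|`**: `(s − 1) Z_f(s) → 2π/√(4ac − b²)` as
`s → 1⁺` (Dirichlet; Bateman–Grosswald, Theorem 1: "a simple pole at `s = 1` with residue `2π/√|d|`").
[cite: BatemanGrosswald1964, Theorem 1] -/
theorem tendsto_sub_one_mul_epsteinZeta (h : IsPosDefForm a b c) :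
    Tendsto (fun s : ℝ => ((s : ℂ) - 1) * epsteinZeta a b c s) (𝓝[>] 1)
      (𝓝 (((2 * π / Real.sqrt (4 * a * c - b ^ 2) : ℝ) : ℂ))) := by
  have hG := tendsto_epsteinZeta_sub_pole h
  set CT := (2 * ((a : ℂ)⁻¹ * riemannZeta 2) +
        ((((a * starkK a b c)⁻¹ : ℝ) : ℂ) *
            ((π : ℂ) * (-(Real.log a : ℂ) - 2 * (Real.log (starkK a b c) : ℂ)) +
              deriv (fun s : ℂ => (π : ℂ) ^ (1 / 2 : ℂ) * Complex.Gamma (s - 1 / 2) / Complex.Gamma s) 1) +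
          2 * Real.eulerMascheroniConstant * ((2 * π / Real.sqrt (4 * a * c - b ^ 2) : ℝ) : ℂ)) +
        2 * ∑' y : ℕ, besselPart (fun _ : ℤ × ℤ => (1 : ℂ)) a b c 1 1 ((y + 1 : ℕ) : ℤ)) with hCT
  set r : ℝ := 2 * π / Real.sqrt (4 * a * c - b ^ 2) with hr
  have h0 : Tendsto (fun s : ℝ => (s : ℂ) - 1) (𝓝[>] 1) (𝓝 0) := by
    have hc : Continuous (fun s : ℝ => (s : ℂ) - 1) := Complex.continuous_ofReal.sub continuous_const
    have := (hc.tendsto (1 : ℝ)).mono_left (nhdsWithin_le_nhds (s := Set.Ioi (1 : ℝ)))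
    simpa using this
  have hT := (h0.mul hG).add (tendsto_const_nhds (x := (r : ℂ)))
  rw [zero_mul, zero_add] at hT
  refine hT.congr' ?_
  filter_upwards [self_mem_nhdsWithin] with s hs
  have hne : (s : ℂ) - 1 ≠ 0 := by
    rw [sub_ne_zero, ← Complex.ofReal_one, Ne, Complex.ofReal_inj]
    exact ne_of_gt hs
  field_simp
  ring

/-! ## The bounded form of Kronecker's limit formula -/

/-- `log a + 2 log κ = log(|d|/a) − log 4` (`κ = √|d|/(2a)`, `|d| = 4ac − b²`). [folklore] -/
theorem log_a_add_two_mul_log_starkK (h : IsPosDefForm a b c) :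
    Real.log a + 2 * Real.log (starkK a b c) = Real.log ((4 * a * c - b ^ 2) / a) - Real.log 4 := by
  have ha := h.a_pos
  have hD : 0 < 4 * a * c - b ^ 2 := by linarith [h.disc_neg]
  have hκ : starkK a b c = Real.sqrt (4 * a * c - b ^ 2) / (2 * a) := rfl
  rw [hκ, Real.log_div (Real.sqrt_pos.mpr hD).ne' (by positivity), Real.log_sqrt hD.le,
    Real.log_mul (by norm_num) ha.ne', Real.log_div hD.ne' ha.ne',
    show (4 : ℝ) = 2 ^ 2 by norm_num, Real.log_pow]
  push_cast
  ring

/-- `(aκ)⁻¹ = (2π/√|d|)/π`. [folklore] -/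
theorem inv_a_mul_starkK (h : IsPosDefForm a b c) :
    (a * starkK a b c)⁻¹ = (2 * π / Real.sqrt (4 * a * c - b ^ 2)) / π := by
  rw [a_mul_starkK h]
  have hπ := Real.pi_pos.ne'
  field_simp

/-- **Kronecker's first limit formula, bounded form.** There is an absolute constant `C` such that
for every positive definite `f = ax² + bxy + cy²` with `e^{−2πκ} ≤ ½` (`κ = √|d|/(2a)`; this holds for
every reduced form, where `κ ≥ √3/2`), the constant term `C_f = lim_{s→1⁺} (Z_f(s) − (2π/√|d|)/(s−1))`
exists and satisfies `‖C_f − (π²/(3a) − (2π/√|d|) log(|d|/a))‖ ≤ C/√|d|`, `|d| = 4ac − b²`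
(`π²/(3a) = 2ζ(2)/a`). Explicitly `C = 2π(log 4 + 2γ + 8) + 2‖c_Γ‖` works. This is the input
"`∑_Q Z_Q` at `s = 1`" of Granville–Stark's (11) (from Selberg–Chowla, p. 109).
[cite: GranvilleStark2000, §3.2 eq. (11)] -/
theorem exists_norm_constantTerm_sub_le :
    ∃ C : ℝ, ∀ a b c : ℝ, IsPosDefForm a b c → Real.exp (-(2 * π * starkK a b c)) ≤ 1 / 2 →
      ∃ CT : ℂ, Tendsto (fun s : ℝ => epsteinZeta a b c s -
          ((2 * π / Real.sqrt (4 * a * c - b ^ 2) : ℝ) : ℂ) / ((s : ℂ) - 1)) (𝓝[>] 1) (𝓝 CT) ∧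
        ‖CT - ((π ^ 2 / (3 * a) - (2 * π / Real.sqrt (4 * a * c - b ^ 2)) *
            Real.log ((4 * a * c - b ^ 2) / a) : ℝ) : ℂ)‖ ≤ C / Real.sqrt (4 * a * c - b ^ 2) := by
  set cΓ : ℂ := deriv (fun s : ℂ => (π : ℂ) ^ (1 / 2 : ℂ) * Complex.Gamma (s - 1 / 2) / Complex.Gamma s) 1
    with hcΓ
  refine ⟨2 * π * (Real.log 4 + 2 * Real.eulerMascheroniConstant + 8) + 2 * ‖cΓ‖, ?_⟩
  intro a b c h hη
  refine ⟨_, tendsto_epsteinZeta_sub_pole h, ?_⟩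
  have ha := h.a_pos
  have hD : 0 < 4 * a * c - b ^ 2 := by linarith [h.disc_neg]
  have hsq : 0 < Real.sqrt (4 * a * c - b ^ 2) := Real.sqrt_pos.mpr hD
  set r : ℝ := 2 * π / Real.sqrt (4 * a * c - b ^ 2) with hr
  have hr0 : 0 < r := by rw [hr]; positivity
  set B₁ : ℂ := ∑' y : ℕ, besselPart (fun _ : ℤ × ℤ => (1 : ℂ)) a b c 1 1 ((y + 1 : ℕ) : ℤ) with hB₁
  have hγ : 0 ≤ Real.eulerMascheroniConstant :=
    (one_half_pos.trans Real.one_half_lt_eulerMascheroniConstant).le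
  have hl4 : 0 ≤ Real.log 4 := Real.log_nonneg (by norm_num)
  -- the Bessel part
  have hB : ‖B₁‖ ≤ 8 * π / (a * starkK a b c) * Real.exp (-(2 * π * starkK a b c)) := by
    have := norm_tsum_besselPart_one_le_of_le_half h one_pos norm_weight_one_le (k := 1)
      (by simpa using hη)
    rw [← hB₁] at this
    simpa only [mul_one, Nat.cast_one, div_one] using this
  have hB' : ‖B₁‖ ≤ 4 * r := by
    refine hB.trans ?_
    have hak : 0 < a * starkK a b c := mul_pos ha (starkK_pos h)
    calc 8 * π / (a * starkK a b c) * Real.exp (-(2 * π * starkK a b c))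
        ≤ 8 * π / (a * starkK a b c) * (1 / 2) := mul_le_mul_of_nonneg_left hη (by positivity)
      _ = 4 * r := by
        rw [div_eq_mul_inv (8 * π), inv_a_mul_starkK h, ← hr]
        have hπ := Real.pi_pos.ne'
        field_simp
        ring
  -- the algebra of the constant term
  have e1 : (((a * starkK a b c)⁻¹ : ℝ) : ℂ) = (r : ℂ) / π := by
    rw [inv_a_mul_starkK h, ← hr]
    push_cast
    rfl
  have e2 : (Real.log a : ℂ) = (Real.log ((4 * a * c - b ^ 2) / a) : ℂ) - Real.log 4
      - 2 * Real.log (starkK a b c) := by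
    have := log_a_add_two_mul_log_starkK h
    rw [show Real.log a = Real.log ((4 * a * c - b ^ 2) / a) - Real.log 4 - 2 * Real.log (starkK a b c)
      by linarith]
    push_cast
    ring
  have hπC : (π : ℂ) ≠ 0 := Complex.ofReal_ne_zero.mpr Real.pi_pos.ne'
  have haC : (a : ℂ) ≠ 0 := Complex.ofReal_ne_zero.mpr ha.ne'
  have hkey : (2 * ((a : ℂ)⁻¹ * riemannZeta 2) +
        ((((a * starkK a b c)⁻¹ : ℝ) : ℂ) *
            ((π : ℂ) * (-(Real.log a : ℂ) - 2 * (Real.log (starkK a b c) : ℂ)) + cΓ) +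
          2 * Real.eulerMascheroniConstant * (r : ℂ)) + 2 * B₁) -
        ((π ^ 2 / (3 * a) - r * Real.log ((4 * a * c - b ^ 2) / a) : ℝ) : ℂ) =
      (r : ℂ) * ((Real.log 4 : ℂ) + cΓ / π + 2 * Real.eulerMascheroniConstant) + 2 * B₁ := by
    rw [riemannZeta_two, e1, e2]
    push_cast
    field_simp
    ring
  rw [hkey]
  -- the estimate
  have hC : (2 * π * (Real.log 4 + 2 * Real.eulerMascheroniConstant + 8) + 2 * ‖cΓ‖) /
      Real.sqrt (4 * a * c - b ^ 2) = r * (Real.log 4 + ‖cΓ‖ / π + 2 * Real.eulerMascheroniConstant + 8) := by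
    rw [hr]
    have hπ := Real.pi_pos.ne'
    field_simp
    ring
  rw [hC]
  have hn1 : ‖(r : ℂ) * ((Real.log 4 : ℂ) + cΓ / π + 2 * Real.eulerMascheroniConstant)‖ ≤
      r * (Real.log 4 + ‖cΓ‖ / π + 2 * Real.eulerMascheroniConstant) := by
    rw [norm_mul, Complex.norm_real, Real.norm_of_nonneg hr0.le]
    refine mul_le_mul_of_nonneg_left ?_ hr0.le
    refine (norm_add_le _ _).trans (add_le_add ((norm_add_le _ _).trans (add_le_add ?_ ?_)) ?_)
    · rw [Complex.norm_real, Real.norm_of_nonneg hl4]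
    · rw [norm_div, Complex.norm_real, Real.norm_of_nonneg Real.pi_pos.le]
    · rw [norm_mul, Complex.norm_real, Real.norm_of_nonneg hγ, Complex.norm_ofNat]
  have hn2 : ‖2 * B₁‖ ≤ 2 * (4 * r) := by
    rw [norm_mul, Complex.norm_ofNat]
    exact mul_le_mul_of_nonneg_left hB' (by norm_num)
  calc ‖(r : ℂ) * ((Real.log 4 : ℂ) + cΓ / π + 2 * Real.eulerMascheroniConstant) + 2 * B₁‖
      ≤ r * (Real.log 4 + ‖cΓ‖ / π + 2 * Real.eulerMascheroniConstant) + 2 * (4 * r) :=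
        (norm_add_le _ _).trans (add_le_add hn1 hn2)
    _ = r * (Real.log 4 + ‖cΓ‖ / π + 2 * Real.eulerMascheroniConstant + 8) := by ring

/-- **Reduced forms satisfy the hypothesis `e^{−2πκ} ≤ ½`**: if `|b| ≤ a ≤ c` then
`4ac − b² ≥ 3a²`, `κ = √(4ac − b²)/(2a) ≥ √3/2 > 5/(2π)`, so `e^{−2πκ} ≤ e^{−5} ≤ ½`. [folklore] -/
theorem exp_neg_two_pi_starkK_le_half (h : IsPosDefForm a b c) (hba : |b| ≤ a) (hac : a ≤ c) :
    Real.exp (-(2 * π * starkK a b c)) ≤ 1 / 2 := by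
  have ha := h.a_pos
  have hb2 : b ^ 2 ≤ a ^ 2 := by
    rw [← sq_abs b]
    exact pow_le_pow_left₀ (abs_nonneg b) hba 2
  have hD3 : 3 * a ^ 2 ≤ 4 * a * c - b ^ 2 := by nlinarith
  -- `κ ≥ √3/2`, and `2πκ ≥ π√3 ≥ 5`
  have hκ : starkK a b c = Real.sqrt (4 * a * c - b ^ 2) / (2 * a) := rfl
  have hsq : Real.sqrt 3 * a ≤ Real.sqrt (4 * a * c - b ^ 2) := by
    rw [show Real.sqrt 3 * a = Real.sqrt (3 * a ^ 2) by
      rw [Real.sqrt_mul (by norm_num), Real.sqrt_sq ha.le]]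
    exact Real.sqrt_le_sqrt hD3
  have h3 : (1.7 : ℝ) ≤ Real.sqrt 3 := by
    rw [show (1.7 : ℝ) = Real.sqrt (1.7 ^ 2) by rw [Real.sqrt_sq (by norm_num)]]
    exact Real.sqrt_le_sqrt (by norm_num)
  have hκ' : 1.7 / 2 ≤ starkK a b c := by
    rw [hκ, div_le_div_iff₀ (by norm_num) (by positivity)]
    nlinarith
  have h5 : (5 : ℝ) ≤ 2 * π * starkK a b c := by nlinarith [Real.pi_gt_three]
  calc Real.exp (-(2 * π * starkK a b c)) ≤ Real.exp (-5) := Real.exp_le_exp.mpr (by linarith)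
    _ ≤ 1 / 2 := by
        rw [Real.exp_neg, inv_le_comm₀ (Real.exp_pos _) (by norm_num)]
        have := Real.add_one_le_exp (5 : ℝ)
        linarith

end Literature.NumberTheory.QuadraticFields.KroneckerLimit
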